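import Summits.CriticalPhenomena.PercolationContinuityZ3.Theorems.PercNearOneGluingNoHeavyLowerTailSahiGridPatternDiagCertLiteralOr

/-!
# `NoHeavyLowerTail` (crux stmt-CriticalPhenomena-4575), Sahi programme P1: **THE THRESHOLD-2 LITERAL-OR (T1) (N′) IDENTITY FOR ARBITRARY SECTION TRIPLES**

Support file (Sahi cell, seat `prim-sahi-p1`, generation 36; `--supports stmt-CriticalPhenomena-4575`).  Pure proofs, no definitions, no `sorry`, standard axioms.
Vocabulary of `…SahiGridPattern{,SliceForm,Kleitman,DiagCertLiteralOr}` (`Pd`, `ind`, `TotDist`, `thirdPt`, `nuCount`, `pairSum_eq_of_sym6_eq`).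

THE MATHEMATICS.  `…DiagCertLiteralTwoOr.diagCert_literalTwoOr_N` proves (N′) for the certificate `(2^k1_V + d, 2^k1_V + d, 2^{k+1} + 2h_V)` of `A = {x₀ = 2} ∨ V`
from two hypothesis instances `N_V[B₀,C₁]`, `N_V[B₁,C₀]`, the modularity term `Σ_q d(q)(1_{B₁}−1_{B₀})(1_{C₁}−1_{C₀})(q)` and ten counting columns.  THIS FILE states
the underlying identity for SEVEN ARBITRARY finsets `B₀, B₁, B₂, C₀, C₁, C₂, V ⊆ [3]^k` and an arbitrary `d : [3]^k → ℤ` (no nesting, no certificate): with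
`[q δ̸ r]` the total-distinctness indicator and `q̄r = thirdPt q r`,
  `Θ_T1(B,C) := Σ_{q δ̸ r}[ (1_{B₀}(q)1_{C₁}(r) + 1_{B₁}(q)1_{C₀}(r))(1_V(q)+1_V(r)−1) + (1_{B₀}(q)1_{C₂}(r) + 1_{B₁}(q)1_{C₂}(r))(1_V(q)+1−1_V(q̄r))
                      + (1_{B₂}(q)1_{C₀}(r) + 1_{B₂}(q)1_{C₁}(r))(1+1_V(r)−1_V(q̄r)) ]`,
  `d′(B∩C) := Σ_q [ (2^k1_V + d)(1_{B₀}1_{C₀} + 1_{B₁}1_{C₁}) + (2^{k+1} + 2·2^k1_V − 2ν_V)1_{B₂}1_{C₂} ](q)`,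
**THEOREM (`literalTwoOr_pair_identity`, `literalTwoOr_budget_sub_theta_eq`):**
  `d′(B∩C) − Θ_T1(B,C) = [d(B₀∩C₁) − Θ_V(B₀×C₁)] + [d(B₁∩C₀) − Θ_V(B₁×C₀)] + Σ_q d(q)(1_{B₁}−1_{B₀})(1_{C₁}−1_{C₀})(q) + 2K + H₁+H₂+H₃+H₄ + p₁ + p₂`
with `Θ_V(P×Q) = Σ_{q δ̸ r}1_P(q)1_Q(r)(1_V(q)+1_V(r)−1_V(q̄r))` and the columns written out (`K = Σ_{q δ̸ r}(1−1_V(q))1_{B₂}(r)(1_{C₂}(r)−1_{C₂}(q̄r))`,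
`H₁ = Σ_{q δ̸ r}1_{B₂}(q)(1_{C₀∩V}(q)−1_{C₀∩V}(r))`, …, `p₂ = Σ_{q δ̸ r}(1−1_V(q))[(1_{B₂}−1_{B₀})(r)(1_{C₂}−1_{C₁})(q̄r) + (1_{B₂}−1_{B₁})(r)(1_{C₂}−1_{C₀})(q̄r)]`).
Each column is `≥ 0` WHEN `V` is an up-set with certificate `d ≥ 0` and the levels are nested up-sets (the situation of `…DiagCertLiteralTwoOr`); the identity
itself needs nothing.  USE (seat memo FROM-prim-sahi-p1-gen36 §2.2): the (N)-slack of the two-payer OR star is the sum of two literal-OR and four threshold-2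
literal-OR line identities on NON-nested section triples; on those lines only the modularity term and `p₁, p₂` can be negative, and the memo's §2.3–2.4 regroup
them.  Nothing here asserts `PatternPos d` for `d ≥ 4` or condition (N) for any block. [this work]
-/

namespace Summit.CriticalPhenomena.PercolationContinuityZ3.Theorems.SahiGridPattern

open Finset SahiGrid3
open scoped BigOperators

variable {k : ℕ}

/-- **The threshold-2 literal-OR (N′) identity in pair-sum form, certificate-free part, arbitrary finsets**: the kernel
`1_V(q)(1_{B₀}1_{C₀}+1_{B₁}1_{C₁})(q) + (2+2·1_V(q)−2·1_V(r))1_{B₂}1_{C₂}(q) + (1_{B₀}(q)1_{C₁}(r)+1_{B₁}(q)1_{C₀}(r))(1−1_V(q̄r)) − [the four level-2 terms of Θ_T1]`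
and the ten-column kernel `2K + H₁..H₄ + p₁ + p₂` have the same sum over totally distinct pairs. [this work] -/
theorem literalTwoOr_pair_identity (B0 B1 B2 C0 C1 C2 V : Finset (Pd k)) :
    (∑ q : Pd k, ∑ r : Pd k, (if TotDist q r = true then (1:ℤ) else 0) *
      ( ind V q * (ind B0 q * ind C0 q + ind B1 q * ind C1 q) + (2 + 2 * ind V q - 2 * ind V r) * (ind B2 q * ind C2 q)
        + (ind B0 q * ind C1 r + ind B1 q * ind C0 r) * (1 - ind V (thirdPt q r))
        - ( (ind B0 q * ind C2 r + ind B1 q * ind C2 r) * (ind V q + 1 - ind V (thirdPt q r))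
            + (ind B2 q * ind C0 r + ind B2 q * ind C1 r) * (1 + ind V r - ind V (thirdPt q r)) ) ))
    = ∑ q : Pd k, ∑ r : Pd k, (if TotDist q r = true then (1:ℤ) else 0) *
      ( 2 * ((1 - ind V q) * (ind B2 r * (ind C2 r - ind C2 (thirdPt q r))))
      + ind B2 q * (ind C0 q * ind V q - ind C0 r * ind V r)
      + ind B2 q * (ind C1 q * ind V q - ind C1 r * ind V r)
      + ind C2 q * (ind B0 q * ind V q - ind B0 r * ind V r)
      + ind C2 q * (ind B1 q * ind V q - ind B1 r * ind V r)
      + ind V q * ((ind B2 q - ind B0 q) * (ind C2 q - ind C0 q) + (ind B2 q - ind B1 q) * (ind C2 q - ind C1 q))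
      + (1 - ind V q) * ((ind B2 r - ind B0 r) * (ind C2 (thirdPt q r) - ind C1 (thirdPt q r))
                          + (ind B2 r - ind B1 r) * (ind C2 (thirdPt q r) - ind C0 (thirdPt q r))) ) := by
  obtain ⟨c1, c2, c3, c4⟩ := And.intro (fun q r => (thirdPt_cancel (k := k) q r).1) (And.intro (fun q r => (thirdPt_cancel (k := k) q r).2.1)
    (And.intro (fun q r => (thirdPt_cancel (k := k) q r).2.2.1) (fun q r => (thirdPt_cancel (k := k) q r).2.2.2)))
  exact pairSum_eq_of_sym6_eq _ _ (fun q r => by simp only [c1, c2, c3, c4, thirdPt_comm r q]; ring)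

/-- Modularity of a point function on two pairs of sets: `d(B₀∩C₀) + d(B₁∩C₁) = d(B₀∩C₁) + d(B₁∩C₀) + Σ d·(1_{B₁}−1_{B₀})(1_{C₁}−1_{C₀})` (pointwise, any sets). [this work] -/
theorem sum_mul_ind_modular (d : Pd k → ℤ) (B0 B1 C0 C1 : Finset (Pd k)) :
    (∑ q : Pd k, d q * (ind B0 q * ind C0 q + ind B1 q * ind C1 q))
      = (∑ q : Pd k, d q * (ind B0 q * ind C1 q)) + (∑ q : Pd k, d q * (ind B1 q * ind C0 q))
        + ∑ q : Pd k, d q * ((ind B1 q - ind B0 q) * (ind C1 q - ind C0 q)) := by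
  rw [← Finset.sum_add_distrib, ← Finset.sum_add_distrib]
  refine Finset.sum_congr rfl fun q _ => ?_
  ring

/-- **The threshold-2 literal-OR (N′) identity, budget form** (arbitrary finsets and arbitrary `d`):
`d′(B∩C) − Θ_T1(B,C) = N_V[B₀,C₁] + N_V[B₁,C₀] + Σ_q d(q)(1_{B₁}−1_{B₀})(1_{C₁}−1_{C₀})(q) + (2K + H₁..H₄ + p₁ + p₂)`,
where `N_V[P,Q] := Σ_{q} d(q)1_P(q)1_Q(q) − Σ_{q δ̸ r}1_P(q)1_Q(r)(1_V(q)+1_V(r)−1_V(q̄r))`. [this work] -/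
theorem literalTwoOr_budget_sub_theta_eq (B0 B1 B2 C0 C1 C2 V : Finset (Pd k)) (d : Pd k → ℤ) :
    (∑ q : Pd k, ((2 ^ k * ind V q + d q) * (ind B0 q * ind C0 q + ind B1 q * ind C1 q)
        + (2 * 2 ^ k + 2 * 2 ^ k * ind V q - 2 * (nuCount V q : ℤ)) * (ind B2 q * ind C2 q)))
    - (∑ q : Pd k, ∑ r : Pd k, (if TotDist q r = true then (1:ℤ) else 0) *
        ( (ind B0 q * ind C1 r + ind B1 q * ind C0 r) * (ind V q + ind V r - 1)
          + (ind B0 q * ind C2 r + ind B1 q * ind C2 r) * (ind V q + 1 - ind V (thirdPt q r))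
          + (ind B2 q * ind C0 r + ind B2 q * ind C1 r) * (1 + ind V r - ind V (thirdPt q r)) ))
    = ( (∑ q : Pd k, d q * (ind B0 q * ind C1 q))
          - ∑ q : Pd k, ∑ r : Pd k, (if TotDist q r = true then (1:ℤ) else 0) * (ind B0 q * ind C1 r * (ind V q + ind V r - ind V (thirdPt q r))) )
      + ( (∑ q : Pd k, d q * (ind B1 q * ind C0 q))
          - ∑ q : Pd k, ∑ r : Pd k, (if TotDist q r = true then (1:ℤ) else 0) * (ind B1 q * ind C0 r * (ind V q + ind V r - ind V (thirdPt q r))) )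
      + (∑ q : Pd k, d q * ((ind B1 q - ind B0 q) * (ind C1 q - ind C0 q)))
      + ∑ q : Pd k, ∑ r : Pd k, (if TotDist q r = true then (1:ℤ) else 0) *
      ( 2 * ((1 - ind V q) * (ind B2 r * (ind C2 r - ind C2 (thirdPt q r))))
      + ind B2 q * (ind C0 q * ind V q - ind C0 r * ind V r)
      + ind B2 q * (ind C1 q * ind V q - ind C1 r * ind V r)
      + ind C2 q * (ind B0 q * ind V q - ind B0 r * ind V r)
      + ind C2 q * (ind B1 q * ind V q - ind B1 r * ind V r)
      + ind V q * ((ind B2 q - ind B0 q) * (ind C2 q - ind C0 q) + (ind B2 q - ind B1 q) * (ind C2 q - ind C1 q))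
      + (1 - ind V q) * ((ind B2 r - ind B0 r) * (ind C2 (thirdPt q r) - ind C1 (thirdPt q r))
                          + (ind B2 r - ind B1 r) * (ind C2 (thirdPt q r) - ind C0 (thirdPt q r))) ) := by
  rw [← literalTwoOr_pair_identity B0 B1 B2 C0 C1 C2 V]
  -- split the budget into its `d`-part and its counting part
  have hsplit : (∑ q : Pd k, ((2 ^ k * ind V q + d q) * (ind B0 q * ind C0 q + ind B1 q * ind C1 q)
        + (2 * 2 ^ k + 2 * 2 ^ k * ind V q - 2 * (nuCount V q : ℤ)) * (ind B2 q * ind C2 q)))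
      = (∑ q : Pd k, d q * (ind B0 q * ind C0 q + ind B1 q * ind C1 q))
        + ∑ q : Pd k, (2 ^ k * ind V q * (ind B0 q * ind C0 q + ind B1 q * ind C1 q)
            + (2 * 2 ^ k + 2 * 2 ^ k * ind V q - 2 * (nuCount V q : ℤ)) * (ind B2 q * ind C2 q)) := by
    rw [← Finset.sum_add_distrib]; refine Finset.sum_congr rfl fun q _ => ?_; ring
  -- the counting part as a pair sum
  have hcount : ∀ q : Pd k, (2 ^ k * ind V q * (ind B0 q * ind C0 q + ind B1 q * ind C1 q)
        + (2 * 2 ^ k + 2 * 2 ^ k * ind V q - 2 * (nuCount V q : ℤ)) * (ind B2 q * ind C2 q))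
      = ∑ r : Pd k, (if TotDist q r = true then (1:ℤ) else 0) *
          (ind V q * (ind B0 q * ind C0 q + ind B1 q * ind C1 q) + (2 + 2 * ind V q - 2 * ind V r) * (ind B2 q * ind C2 q)) := by
    intro q
    have e1 : (2:ℤ) ^ k * (ind V q * (ind B0 q * ind C0 q + ind B1 q * ind C1 q) + (2 + 2 * ind V q) * (ind B2 q * ind C2 q))
        = ∑ r : Pd k, (if TotDist q r = true then (1:ℤ) else 0) *
            (ind V q * (ind B0 q * ind C0 q + ind B1 q * ind C1 q) + (2 + 2 * ind V q) * (ind B2 q * ind C2 q)) := by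
      rw [← Finset.sum_mul, sum_ite_totDist_eq_two_pow]
    have e2 : (nuCount V q : ℤ) * (ind B2 q * ind C2 q) = ∑ r : Pd k, (if TotDist q r = true then (1:ℤ) else 0) * (ind V r * (ind B2 q * ind C2 q)) := by
      rw [nuCount_eq_sum_ind, Finset.sum_mul]
      refine Finset.sum_congr rfl fun r _ => ?_
      rw [totDist_symm r q]; ring
    have e3 : (∑ r : Pd k, (if TotDist q r = true then (1:ℤ) else 0) *
          (ind V q * (ind B0 q * ind C0 q + ind B1 q * ind C1 q) + (2 + 2 * ind V q - 2 * ind V r) * (ind B2 q * ind C2 q)))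
        = (∑ r : Pd k, (if TotDist q r = true then (1:ℤ) else 0) *
            (ind V q * (ind B0 q * ind C0 q + ind B1 q * ind C1 q) + (2 + 2 * ind V q) * (ind B2 q * ind C2 q)))
          - 2 * ∑ r : Pd k, (if TotDist q r = true then (1:ℤ) else 0) * (ind V r * (ind B2 q * ind C2 q)) := by
      rw [Finset.mul_sum, ← Finset.sum_sub_distrib]
      refine Finset.sum_congr rfl fun r _ => ?_
      ring
    rw [e3, ← e1, ← e2]
    ring
  -- the two hypothesis kernels together with the cross terms of Θ_T1
  have hpair : ∀ q : Pd k,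
      (∑ r : Pd k, (if TotDist q r = true then (1:ℤ) else 0) *
          (ind V q * (ind B0 q * ind C0 q + ind B1 q * ind C1 q) + (2 + 2 * ind V q - 2 * ind V r) * (ind B2 q * ind C2 q)))
      - (∑ r : Pd k, (if TotDist q r = true then (1:ℤ) else 0) *
          ( (ind B0 q * ind C1 r + ind B1 q * ind C0 r) * (ind V q + ind V r - 1)
            + (ind B0 q * ind C2 r + ind B1 q * ind C2 r) * (ind V q + 1 - ind V (thirdPt q r))
            + (ind B2 q * ind C0 r + ind B2 q * ind C1 r) * (1 + ind V r - ind V (thirdPt q r)) ))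
      = (∑ r : Pd k, (if TotDist q r = true then (1:ℤ) else 0) *
          ( ind V q * (ind B0 q * ind C0 q + ind B1 q * ind C1 q) + (2 + 2 * ind V q - 2 * ind V r) * (ind B2 q * ind C2 q)
            + (ind B0 q * ind C1 r + ind B1 q * ind C0 r) * (1 - ind V (thirdPt q r))
            - ( (ind B0 q * ind C2 r + ind B1 q * ind C2 r) * (ind V q + 1 - ind V (thirdPt q r))
                + (ind B2 q * ind C0 r + ind B2 q * ind C1 r) * (1 + ind V r - ind V (thirdPt q r)) ) ))
        - (∑ r : Pd k, (if TotDist q r = true then (1:ℤ) else 0) * (ind B0 q * ind C1 r * (ind V q + ind V r - ind V (thirdPt q r))))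
        - (∑ r : Pd k, (if TotDist q r = true then (1:ℤ) else 0) * (ind B1 q * ind C0 r * (ind V q + ind V r - ind V (thirdPt q r)))) := by
    intro q
    rw [← Finset.sum_sub_distrib, ← Finset.sum_sub_distrib, ← Finset.sum_sub_distrib]
    refine Finset.sum_congr rfl fun r _ => ?_
    ring
  rw [hsplit, sum_mul_ind_modular d B0 B1 C0 C1, Finset.sum_congr rfl fun q _ => hcount q]
  have hfin : ((∑ q : Pd k, ∑ r : Pd k, (if TotDist q r = true then (1:ℤ) else 0) *
          (ind V q * (ind B0 q * ind C0 q + ind B1 q * ind C1 q) + (2 + 2 * ind V q - 2 * ind V r) * (ind B2 q * ind C2 q)))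
      - (∑ q : Pd k, ∑ r : Pd k, (if TotDist q r = true then (1:ℤ) else 0) *
          ( (ind B0 q * ind C1 r + ind B1 q * ind C0 r) * (ind V q + ind V r - 1)
            + (ind B0 q * ind C2 r + ind B1 q * ind C2 r) * (ind V q + 1 - ind V (thirdPt q r))
            + (ind B2 q * ind C0 r + ind B2 q * ind C1 r) * (1 + ind V r - ind V (thirdPt q r)) )))
      = (∑ q : Pd k, ∑ r : Pd k, (if TotDist q r = true then (1:ℤ) else 0) *
          ( ind V q * (ind B0 q * ind C0 q + ind B1 q * ind C1 q) + (2 + 2 * ind V q - 2 * ind V r) * (ind B2 q * ind C2 q)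
            + (ind B0 q * ind C1 r + ind B1 q * ind C0 r) * (1 - ind V (thirdPt q r))
            - ( (ind B0 q * ind C2 r + ind B1 q * ind C2 r) * (ind V q + 1 - ind V (thirdPt q r))
                + (ind B2 q * ind C0 r + ind B2 q * ind C1 r) * (1 + ind V r - ind V (thirdPt q r)) ) ))
        - (∑ q : Pd k, ∑ r : Pd k, (if TotDist q r = true then (1:ℤ) else 0) * (ind B0 q * ind C1 r * (ind V q + ind V r - ind V (thirdPt q r))))
        - (∑ q : Pd k, ∑ r : Pd k, (if TotDist q r = true then (1:ℤ) else 0) * (ind B1 q * ind C0 r * (ind V q + ind V r - ind V (thirdPt q r)))) := by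
    rw [← Finset.sum_sub_distrib, ← Finset.sum_sub_distrib, ← Finset.sum_sub_distrib]
    exact Finset.sum_congr rfl fun q _ => hpair q
  linarith [hfin]

end Summit.CriticalPhenomena.PercolationContinuityZ3.Theorems.SahiGridPattern
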